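import Literature.IUT.HodgeArakelov.ThetaQuotientDataNonVacuity
import HarnessLib

/-!
# [IUTchII] Rmk. 1.1.1 (iii), last sentence, at the [EtTh] model: the DIFFERENCE OF THE TWO SECTIONS versus the
# Def. 1.1 (ii) rigidity isomorphism of bridge B8 — a SIGN-CONVENTION record (proof-only)

Mochizuki, *Inter-universal Teichmüller theory II*, §1, Remark 1.1.1 (iii), kurims manuscript (Dec. 2020) p. 23
[claim: Mochizuki2012, status: disputed] (IUTchII §1 Rmk 1.1.1 (iii), kurims p.23): "The mono-theta-theoretic cyclotomic
rigidity isomorphism of Definition 1.1, (ii), is then reconstructed [cf. [EtTh], Corollary 2.19, (i)] by forming the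
difference of the two sections `s^Θ(M)|_{(l·Δ_Θ)}`, `s^alg(M)|_{(l·Δ_Θ)}`"; [EtTh] Cor. 2.19 (i) p. 64
[cite: MochizukiEtTh2009, Cor 2.19(i) p.64]. abc-iut cell, layer L6, seat abc-iut-w5-d225 (gen 5); sequel of the
NV-L6 rows CoreTower / TwoSections (`CoreTowerNonVacuity`, `TwoSectionsNonVacuity`). abc-iut-L6-t1 typed the sentence
as `rigidity_is_difference Sec C` (`MonoThetaSymmetries.lean`): for lifts `t ∈ s^Θ`, `s ∈ s^alg` over `a`, the class of
`m := C.iso (a mod N)` equals `t · s⁻¹`.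

THIS FILE records, for EVERY [EtTh] rigidity interface `R : RigidData S.N l` framed by abc-iut-L6-d6's
`F : ModelFrame S R` and identification `e : Π_M ≃ Π^tp_{Y̲̲}[μ_N]` (B8 part 5b), how the two available kernel objects
compare IN `Π_M`:
* `ModelFrame.cyclotomicRigidity_iso_mk` — B8's Def. 1.1 (ii) isomorphism `(F.cyclotomicRigidity e).iso` sends the
  class of `g ∈ (l·Δ_Θ)`-preimage to `extEquiv e (thetaMod g) = e⁻¹(ι_μ(thetaMod g))` (`rfl` through abc-iut-L6-d6's
  `ModelCyclotomes.intModEquiv`);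
* `ModelFrame.sAlg_mul_sTheta_inv_eq_iso` — with abc-iut-L2-t2's sections (`ThetaEnvData.sTheta hη g = ⟨(η g)⁻¹, g⟩`,
  the "`η⁻¹`-convention", and `sAlg`), `e⁻¹(s^alg g) · e⁻¹(s^Θ_η g)⁻¹ = ` that value (L2's `RigidData.sAlg_mul_sTheta_inv`
  transported along `e⁻¹`);
* `ModelFrame.sTheta_mul_sAlg_inv_eq_iso_inv` — hence `e⁻¹(s^Θ_η g) · e⁻¹(s^alg g)⁻¹ = ` the INVERSE of that value.
CONSEQUENCE (stated here in prose only, nothing about it is asserted in the kernel): for a two-sections datum whose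
`s^Θ|_{(l·Δ_Θ)}` consists of the classes of `e⁻¹ ∘ s^Θ_η` (as in `TwoSectionsNonVacuity.lean`), the typed clause
`rigidity_is_difference Sec (F.cyclotomicRigidity e)` ("`m = t · s⁻¹`") amounts to `m = m⁻¹` modulo `e⁻¹(s^alg(thetaKer))`,
i.e. to `(thetaMod g)² = 1`; with the opposite (and equally legitimate: `η ↦ η⁻¹` preserves cocycles with abelian
coefficients) section convention `g ↦ η(g)·s^alg(g)`, or reading "difference" as `s · t⁻¹`, it holds on the nose. A
convention record for whoever assembles `Rmk111_structures` at the model; NOT a finding against print (which fixes no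
sign). PROOF-ONLY. HONEST FRAMING: kernel facts about the cell's own model objects; nothing of [IUTchII] asserted; no
side taken on [IUTchIII] Cor. 3.12 (node outside the cone); typed ≠ discharged.
-/

noncomputable section

namespace Literature.IUT.HodgeArakelov

open Literature.AnabelianGeometry.EtaleTheta

universe u

namespace ModelFrame

open ModelCyclotomes

variable {S : ThetaSetting.{u}} {l : ℕ} {R : RigidData.{u} S.N l}

/-- **The value of B8's Def. 1.1 (ii) rigidity isomorphism on a class**: for `g` in the `(l·Δ_Θ)`-preimage,
`(F.cyclotomicRigidity e).iso [g] = extEquiv e (thetaMod g)` (`= e⁻¹(ι_μ(thetaMod g))` as an element of `Π_M`,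
`coe_extEquiv`). Definitional (`rfl`). [claim: Mochizuki2012, status: disputed] (IUTchII §1 Def 1.1 (ii), kurims p.21) -/
theorem cyclotomicRigidity_iso_mk (F : ModelFrame S R) {M : MonoThetaEnv S} (e : M.Pi ≃ₜ* R.env)
    (g : ↥R.lDeltaTheta) :
    (F.cyclotomicRigidity e).iso
        (QuotientGroup.mk (QuotientGroup.mk (⟨⟨(g : R.PiX), lDeltaTheta_le_PiY R g.2⟩, g.2⟩ :
          ↥(intCyc R).top) : (intCyc R).carrier)) =
      extEquiv e (R.thetaMod g) := by
  rfl

/-- **`s · t⁻¹ = m`**: in `Π_M`, `e⁻¹(s^alg g) · e⁻¹(s^Θ_η g)⁻¹` IS the value of the Def. 1.1 (ii) isomorphism on `[g]`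
(L2's `RigidData.sAlg_mul_sTheta_inv` — "the natural isomorphism of cyclotomes determined by `s^alg`, `s^Θ`",
[EtTh] Cor. 2.19 (i) — transported along `e⁻¹`). [cite: MochizukiEtTh2009, Cor 2.19(i) p.64] -/
theorem sAlg_mul_sTheta_inv_eq_iso (F : ModelFrame S R) {M : MonoThetaEnv S} (e : M.Pi ≃ₜ* R.env)
    {η : R.PiYdd → R.mu} (hη : η ∈ R.thetaCocycles) (g : ↥R.lDeltaTheta) :
    e.symm (R.toThetaEnvData.sAlg ⟨(g : R.PiX), (Subgroup.mem_inf.1 (R.lDeltaTheta_le g.2)).1⟩) *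
        (e.symm (R.toThetaEnvData.sTheta hη ⟨(g : R.PiX), (Subgroup.mem_inf.1 (R.lDeltaTheta_le g.2)).1⟩))⁻¹ =
      (((F.cyclotomicRigidity e).iso
        (QuotientGroup.mk (QuotientGroup.mk (⟨⟨(g : R.PiX), lDeltaTheta_le_PiY R g.2⟩, g.2⟩ :
          ↥(intCyc R).top) : (intCyc R).carrier)) : M.Pi)) := by
  rw [cyclotomicRigidity_iso_mk, coe_extEquiv,
    ← R.sAlg_mul_sTheta_inv hη ⟨(g : R.PiX), (Subgroup.mem_inf.1 (R.lDeltaTheta_le g.2)).1⟩ g.2]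
  simp only [map_mul, map_inv]

/-- **`t · s⁻¹ = m⁻¹`**: with L2's `η⁻¹`-convention theta section, `e⁻¹(s^Θ_η g) · e⁻¹(s^alg g)⁻¹` is the INVERSE of
the value of the Def. 1.1 (ii) isomorphism on `[g]` — the order of the "difference of the two sections" that
abc-iut-L6-t1's `rigidity_is_difference` types (`t · s⁻¹`) meets B8's isomorphism with a sign (convention record; see
the module docstring). [claim: Mochizuki2012, status: disputed] (IUTchII §1 Rmk 1.1.1 (iii), kurims p.23) -/
theorem sTheta_mul_sAlg_inv_eq_iso_inv (F : ModelFrame S R) {M : MonoThetaEnv S} (e : M.Pi ≃ₜ* R.env)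
    {η : R.PiYdd → R.mu} (hη : η ∈ R.thetaCocycles) (g : ↥R.lDeltaTheta) :
    e.symm (R.toThetaEnvData.sTheta hη ⟨(g : R.PiX), (Subgroup.mem_inf.1 (R.lDeltaTheta_le g.2)).1⟩) *
        (e.symm (R.toThetaEnvData.sAlg ⟨(g : R.PiX), (Subgroup.mem_inf.1 (R.lDeltaTheta_le g.2)).1⟩))⁻¹ =
      (((F.cyclotomicRigidity e).iso
        (QuotientGroup.mk (QuotientGroup.mk (⟨⟨(g : R.PiX), lDeltaTheta_le_PiY R g.2⟩, g.2⟩ :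
          ↥(intCyc R).top) : (intCyc R).carrier)) : M.Pi))⁻¹ := by
  rw [← sAlg_mul_sTheta_inv_eq_iso F e hη g, mul_inv_rev, inv_inv]

end ModelFrame

end Literature.IUT.HodgeArakelov

end
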